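import Summits.CriticalPhenomena.PercolationContinuityZ3.Theorems.PercGamblersRuinVerticalGamblersRuinStubPathReversal

/-!
# Route `PercGamblersRuin`, crux `VerticalGamblersRuin` (stmt-CriticalPhenomena-10642):
# stub `stub_toeplitzPositivity` — helper file (algebra, environment operator)

First helper file for the stub `stub_toeplitzPositivity` of the line `registered` (skeleton
rev 10, Theorem A(ii): positivity of the Fejér sums of the autocovariances of the reversible
environment chain) of the crux `PercGamblersRuin.VerticalGamblersRuin`; the stub itself is
proved in `Theorems/PercGamblersRuinVerticalGamblersRuinStubToeplitzPositivity.lean`.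

Setting.  Bond configurations `ω` on `ℤ³` under `P = P_{p_c}`; `N_ω(x)` is the set of lattice
neighbours `y ∼ x` with `s(x, y)` open in `ω`, `deg_ω(0) = #N_ω(0)`;
`ω - x = BondConfig.relabel (sym2Equiv (Site.shift (-x))) ω` is the configuration seen from `x`;
`𝒫_ω` is the unkilled one-step averaging operator (pinned by `hPop`).  The ENVIRONMENT OPERATOR
("environment seen from the walker") is
`(S k)(ω) = (𝒫_ω (x ↦ k(ω - x)))(0) = (∑_{y ∈ N_ω(0)} k(ω - y)) / deg_ω(0)`; it enters every
lemma as a function `S` pinned by its formula (`hS`).  The (un-normalised) inner product is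
`⟨f, k⟩ = ∫_{0↔∞} deg_ω(0)·f·k dP`.

Contents.  (1) ALGEBRA: for a real sequence `c` put `Q_n = ∑_{i,i' ≤ n} c_{i+i'}`,
`R_n = ∑_{i,i' ≤ n} c_{i+i'+2}`; the telescoping identity
`2·∑_{r ≤ m} (m+1-r) c_r = (m+1)·c_0 + Q_m + ∑_{n < m} (Q_n - R_n)` (`two_mul_fejer_sum`, the
sum over `a, b ≤ m` of `λ^{|a-b|} = λ^{a+b} + ∑_{j=1}^{min(a,b)} λ^{a-j}(1-λ²)λ^{b-j}` read on the
numbers `c`) and its consequence `fejer_sum_nonneg`.  (2) Integrability of `deg·f` for bounded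
measurable `f`, bilinearity of `⟨·,·⟩` over finite sums, and the SIGNED summed one-step
translation identity `setIntegral_sum_relabel_bdd` (from
`StubStationarity.setIntegral_ite_relabel`).
(3) The operator `S`: measurability and bounds of `S k` and of the iterates `S^[r] k`, the
ITERATE COVARIANCE `(𝒫_ω^[r] (x ↦ k(ω - x)))(0) = (S^r k)(ω)` (`StubStationarity.pop_seen_from`),
linearity over finite sums, `deg·(S k) = ∑_{y ∈ N_ω(0)} k(ω - y)`, and the pointwise Jensen
inequality `deg·(S u)² ≤ deg·S(u²)`.

## References

* C. Kipnis, S. R. S. Varadhan, *Central limit theorem for additive functionals of reversible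
  Markov processes and applications to simple exclusions*, Comm. Math. Phys. 104 (1986), 1–19,
  §1 (autocovariances of a reversible stationary chain).
* A. De Masi, P. A. Ferrari, S. Goldstein, W. D. Wick, *An invariance principle for reversible
  Markov processes. Applications to random motions in random environments*, J. Statist. Phys.
  55 (1989), 787–855, §4 (the environment seen from the walker on the cluster).
-/

noncomputable section

namespace Summit.CriticalPhenomena.PercolationContinuityZ3.Theorems.VerticalGamblersRuin

open MeasureTheory Filter Topology
open Literature.Probability.Percolation Literature.Probability.LatticeModels
open scoped Classical

namespace StubToeplitzPositivity

/-! ### Algebra: Fejér sums of a sequence with `Q_n ≥ 0` and `R_n ≤ Q_n` -/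

/-- Peeling the indices `i = 0` and `i' = 0` off the double sum `∑_{i,i' ≤ n+1} c(i+i')`:
`Q_{n+1} = R_n + ∑_{i ≤ n} c(i+1) + ∑_{i' ≤ n+1} c(i')`. -/
theorem sum_sum_range_succ (c : ℕ → ℝ) (n : ℕ) :
    ∑ i ∈ Finset.range (n + 1 + 1), ∑ i' ∈ Finset.range (n + 1 + 1), c (i + i') =
      ∑ i ∈ Finset.range (n + 1), ∑ i' ∈ Finset.range (n + 1), c (i + i' + 2) +
        ∑ i ∈ Finset.range (n + 1), c (i + 1) + ∑ i' ∈ Finset.range (n + 1 + 1), c i' := by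
  rw [Finset.sum_range_succ' (fun i => ∑ i' ∈ Finset.range (n + 1 + 1), c (i + i'))]
  simp only [zero_add]
  congr 1
  rw [← Finset.sum_add_distrib]
  refine Finset.sum_congr rfl fun i _ => ?_
  rw [Finset.sum_range_succ' (fun i' => c (i + 1 + i'))]
  simp only [add_zero]
  congr 1
  refine Finset.sum_congr rfl fun i' _ => ?_
  congr 1
  omega

/-- **The telescoping identity.**  For every real sequence `c`,
`2·∑_{r ≤ m} (m+1-r) c_r = (m+1)·c_0 + Q_m + ∑_{n < m} (Q_n - R_n)` with
`Q_n = ∑_{i,i' ≤ n} c_{i+i'}` and `R_n = ∑_{i,i' ≤ n} c_{i+i'+2}` (the sum over `a, b ≤ m` of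
`λ^{|a-b|} = λ^{a+b} + ∑_{j=1}^{min(a,b)} λ^{a-j}(1-λ²)λ^{b-j}`, read on the numbers `c`;
induction on `m` using `sum_sum_range_succ`). -/
theorem two_mul_fejer_sum (c : ℕ → ℝ) (m : ℕ) :
    2 * ∑ r ∈ Finset.range (m + 1), ((m : ℝ) + 1 - r) * c r =
      ((m : ℝ) + 1) * c 0 +
        ∑ i ∈ Finset.range (m + 1), ∑ i' ∈ Finset.range (m + 1), c (i + i') +
        ∑ n ∈ Finset.range m,
          (∑ i ∈ Finset.range (n + 1), ∑ i' ∈ Finset.range (n + 1), c (i + i') -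
            ∑ i ∈ Finset.range (n + 1), ∑ i' ∈ Finset.range (n + 1), c (i + i' + 2)) := by
  induction m with
  | zero =>
    simp only [zero_add, Finset.range_one, Finset.sum_singleton, CharP.cast_eq_zero, sub_zero,
      one_mul, add_zero, Finset.range_zero, Finset.sum_empty]
    ring
  | succ m ih =>
    have hT : ∑ r ∈ Finset.range (m + 1 + 1), (((m + 1 : ℕ) : ℝ) + 1 - r) * c r =
        ∑ r ∈ Finset.range (m + 1), ((m : ℝ) + 1 - r) * c r +
          ∑ r ∈ Finset.range (m + 1 + 1), c r := by
      rw [Finset.sum_range_succ, Finset.sum_range_succ c, ← add_assoc, ← Finset.sum_add_distrib]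
      push_cast
      congr 1
      · exact Finset.sum_congr rfl fun r _ => by ring
      · ring
    rw [hT, sum_sum_range_succ c m, Finset.sum_range_succ (fun n =>
        ∑ i ∈ Finset.range (n + 1), ∑ i' ∈ Finset.range (n + 1), c (i + i') -
          ∑ i ∈ Finset.range (n + 1), ∑ i' ∈ Finset.range (n + 1), c (i + i' + 2)) m,
      eq_sub_of_add_eq (Finset.sum_range_succ' c (m + 1)).symm]
    push_cast
    linear_combination ih

/-- **Positivity of the Fejér sums.**  If `Q_n ≥ 0` and `R_n ≤ Q_n` for all `n` (notation of
`two_mul_fejer_sum`), then `0 ≤ ∑_{r ≤ m} (m+1-r) c_r` (note `c_0 = Q_0 ≥ 0`). -/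
theorem fejer_sum_nonneg (c : ℕ → ℝ) (m : ℕ)
    (hQ : ∀ n, 0 ≤ ∑ i ∈ Finset.range (n + 1), ∑ i' ∈ Finset.range (n + 1), c (i + i'))
    (hR : ∀ n, ∑ i ∈ Finset.range (n + 1), ∑ i' ∈ Finset.range (n + 1), c (i + i' + 2) ≤
      ∑ i ∈ Finset.range (n + 1), ∑ i' ∈ Finset.range (n + 1), c (i + i')) :
    0 ≤ ∑ r ∈ Finset.range (m + 1), ((m : ℝ) + 1 - r) * c r := by
  have h := two_mul_fejer_sum c m
  have h0 : 0 ≤ c 0 := by simpa using hQ 0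
  have h1 : 0 ≤ ((m : ℝ) + 1) * c 0 := mul_nonneg (by positivity) h0
  have h2 : 0 ≤ ∑ n ∈ Finset.range m,
      (∑ i ∈ Finset.range (n + 1), ∑ i' ∈ Finset.range (n + 1), c (i + i') -
        ∑ i ∈ Finset.range (n + 1), ∑ i' ∈ Finset.range (n + 1), c (i + i' + 2)) :=
    Finset.sum_nonneg fun n _ => sub_nonneg.2 (hR n)
  linarith [hQ m]

/-! ### Integrability, bilinearity, and the signed one-step translation identity -/

/-- For a bounded measurable `f`, `ω ↦ deg_ω(0) · f(ω)` is integrable for every finite measure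
(`deg ≤ 6`, `DeterministicTime.deg_le_six`). -/
theorem integrable_card_mul {f : BondConfig (Site 3) → ℝ} (hf : Measurable f) {M : ℝ}
    (hb : ∀ ω, |f ω| ≤ M) (μ : Measure (BondConfig (Site 3))) [IsFiniteMeasure μ] :
    Integrable (fun ω => ((((zdGraph 3).neighborFinset (0 : Site 3)).filter
        (fun y => s((0 : Site 3), y) ∈ ω)).card : ℝ) * f ω) μ :=
  Integrable.of_bound (StubStationarity.measurable_card_filter_zero.mul hf).aestronglyMeasurable
    (6 * M) (Eventually.of_forall fun ω => by
      rw [Real.norm_eq_abs, abs_mul, Nat.abs_cast]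
      exact mul_le_mul (DeterministicTime.deg_le_six ω 0) (hb ω) (abs_nonneg _) (by norm_num))

/-- `|f ω · k ω| ≤ M_f · M_k` for bounded `f`, `k`. -/
theorem abs_mul_le {f k : BondConfig (Site 3) → ℝ} {Mf Mk : ℝ} (hf : ∀ ω, |f ω| ≤ Mf)
    (hk : ∀ ω, |k ω| ≤ Mk) (ω : BondConfig (Site 3)) : |f ω * k ω| ≤ Mf * Mk := by
  rw [abs_mul]
  exact mul_le_mul (hf ω) (hk ω) (abs_nonneg _) ((abs_nonneg _).trans (hf ω))

/-- A finite sum of functions bounded by `M` is bounded by `#terms · M`. -/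
theorem abs_sum_le {ι : Type*} (t : Finset ι) {f : ι → BondConfig (Site 3) → ℝ} {M : ℝ}
    (hb : ∀ i ω, |f i ω| ≤ M) (ω : BondConfig (Site 3)) :
    |∑ i ∈ t, f i ω| ≤ (t.card : ℝ) * M := by
  refine (Finset.abs_sum_le_sum_abs _ _).trans
    ((Finset.sum_le_sum fun i _ => hb i ω).trans_eq ?_)
  rw [Finset.sum_const, nsmul_eq_mul]

/-- **Bilinearity**: `⟨∑_i f_i, ∑_j f_j⟩ = ∑_i ∑_j ⟨f_i, f_j⟩` for bounded measurable `f_i`. -/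
theorem setIntegral_card_mul_sum_mul_sum {ι : Type*} (t : Finset ι)
    (f : ι → BondConfig (Site 3) → ℝ) (hf : ∀ i, Measurable (f i)) {M : ℝ}
    (hb : ∀ i ω, |f i ω| ≤ M) :
    ∫ ω in percolatesAt (0 : Site 3),
        ((((zdGraph 3).neighborFinset (0 : Site 3)).filter
            (fun y => s((0 : Site 3), y) ∈ ω)).card : ℝ) *
          ((∑ i ∈ t, f i ω) * ∑ j ∈ t, f j ω) ∂(bondPercolation (zdGraph 3) (criticalProbI 3)) =
      ∑ i ∈ t, ∑ j ∈ t, ∫ ω in percolatesAt (0 : Site 3),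
        ((((zdGraph 3).neighborFinset (0 : Site 3)).filter
            (fun y => s((0 : Site 3), y) ∈ ω)).card : ℝ) * (f i ω * f j ω)
        ∂(bondPercolation (zdGraph 3) (criticalProbI 3)) := by
  have h : ∀ ω : BondConfig (Site 3), ((((zdGraph 3).neighborFinset (0 : Site 3)).filter
      (fun y => s((0 : Site 3), y) ∈ ω)).card : ℝ) * ((∑ i ∈ t, f i ω) * ∑ j ∈ t, f j ω) =
      ∑ i ∈ t, ∑ j ∈ t, ((((zdGraph 3).neighborFinset (0 : Site 3)).filter
        (fun y => s((0 : Site 3), y) ∈ ω)).card : ℝ) * (f i ω * f j ω) := fun ω => by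
    rw [Finset.sum_mul_sum, Finset.mul_sum]
    exact Finset.sum_congr rfl fun i _ => Finset.mul_sum _ _ _
  have hI : ∀ i j, Integrable (fun ω => ((((zdGraph 3).neighborFinset (0 : Site 3)).filter
      (fun y => s((0 : Site 3), y) ∈ ω)).card : ℝ) * (f i ω * f j ω))
      ((bondPercolation (zdGraph 3) (criticalProbI 3)).restrict (percolatesAt (0 : Site 3))) :=
    fun i j => integrable_card_mul (f := fun ω => f i ω * f j ω) ((hf i).mul (hf j))
      (abs_mul_le (hb i) (hb j)) _
  simp only [h]
  rw [integral_finsetSum _ fun i _ => integrable_finsetSum _ fun j _ => hI i j]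
  exact Finset.sum_congr rfl fun i _ => integral_finsetSum _ fun j _ => hI i j

/-- **The one-step translation identity, summed over the open neighbours of the origin**, for a
BOUNDED `F(ω', z)` measurable in `ω'` (signed version of
`StubPathReversal.setIntegral_sum_relabel`):
`∫_{0↔∞} ∑_{z ∈ N_ω(0)} F(ω - z, z) dP = ∫_{0↔∞} ∑_{y ∈ N_ω(0)} F(ω, -y) dP`
(`StubStationarity.setIntegral_ite_relabel` for each lattice neighbour, reindexed by `y = -z`). -/
theorem setIntegral_sum_relabel_bdd (Fz : BondConfig (Site 3) → Site 3 → ℝ)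
    (hF : ∀ z, Measurable fun ω => Fz ω z) {M : ℝ} (hb : ∀ ω z, |Fz ω z| ≤ M) :
    ∫ ω in percolatesAt (0 : Site 3),
        (∑ z ∈ ((zdGraph 3).neighborFinset (0 : Site 3)).filter
            (fun y => s((0 : Site 3), y) ∈ ω),
          Fz (BondConfig.relabel (sym2Equiv (Site.shift (-z))) ω) z)
        ∂(bondPercolation (zdGraph 3) (criticalProbI 3)) =
      ∫ ω in percolatesAt (0 : Site 3),
        (∑ y ∈ ((zdGraph 3).neighborFinset (0 : Site 3)).filter
            (fun y => s((0 : Site 3), y) ∈ ω), Fz ω (-y))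
        ∂(bondPercolation (zdGraph 3) (criticalProbI 3)) := by
  have hI1 : ∀ z ∈ (zdGraph 3).neighborFinset (0 : Site 3),
      Integrable (fun ω : BondConfig (Site 3) => if s((0 : Site 3), z) ∈ ω then
        Fz (BondConfig.relabel (sym2Equiv (Site.shift (-z))) ω) z else 0)
        ((bondPercolation (zdGraph 3) (criticalProbI 3)).restrict (percolatesAt (0 : Site 3))) :=
    fun z _ => Integrable.of_bound
      (StubStationarity.measurable_ite_relabel (hF z) z).aestronglyMeasurable (max M 0)
      (Eventually.of_forall fun ω => by
        split_ifs
        · exact ((Real.norm_eq_abs _).le.trans (hb _ _)).trans (le_max_left _ _)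
        · exact norm_zero.le.trans (le_max_right _ _))
  have hI2 : ∀ y ∈ (zdGraph 3).neighborFinset (0 : Site 3),
      Integrable (fun ω : BondConfig (Site 3) => if s((0 : Site 3), y) ∈ ω then Fz ω (-y) else 0)
        ((bondPercolation (zdGraph 3) (criticalProbI 3)).restrict (percolatesAt (0 : Site 3))) :=
    fun y _ => Integrable.of_bound (Measurable.ite (measurableSet_mem
      (s((0 : Site 3), y) : Sym2 (Site 3))) (hF (-y)) measurable_const).aestronglyMeasurable
      (max M 0) (Eventually.of_forall fun ω => by
        split_ifs
        · exact ((Real.norm_eq_abs _).le.trans (hb _ _)).trans (le_max_left _ _)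
        · exact norm_zero.le.trans (le_max_right _ _))
  simp only [Finset.sum_filter]
  rw [integral_finsetSum _ hI1, integral_finsetSum _ hI2]
  refine Finset.sum_equiv (Equiv.neg (Site 3)) (fun z => ?_) (fun z hz => ?_)
  · rw [SimpleGraph.mem_neighborFinset, SimpleGraph.mem_neighborFinset, Equiv.neg_apply,
      ← StubStationarity.zdGraph_adj_neg_zero_iff z]
    exact (zdGraph 3).adj_comm _ _
  · rw [StubStationarity.setIntegral_ite_relabel (fun ω => Fz ω z)
      ((SimpleGraph.mem_neighborFinset _ _ _).1 hz), Equiv.neg_apply, neg_neg, Sym2.eq_swap]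

/-! ### The environment operator `S`: measurability, bounds, iterate covariance, linearity -/

section Operator

variable {Pop : BondConfig (Site 3) → (Site 3 → ℝ) → Site 3 → ℝ}
  (hPop : ∀ ω (g : Site 3 → ℝ) (x : Site 3), Pop ω g x =
    (∑ y ∈ ((zdGraph 3).neighborFinset x).filter (fun y => s(x, y) ∈ ω), g y) /
      ((((zdGraph 3).neighborFinset x).filter (fun y => s(x, y) ∈ ω)).card : ℝ))
  {S : (BondConfig (Site 3) → ℝ) → BondConfig (Site 3) → ℝ}
  (hS : ∀ (k : BondConfig (Site 3) → ℝ) (ω : BondConfig (Site 3)),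
    S k ω = Pop ω (fun x => k (BondConfig.relabel (sym2Equiv (Site.shift (-x))) ω)) 0)
include hPop hS

/-- `S k` is measurable for measurable `k` (`StubStationarity.measurable_pop_zero`). -/
theorem measurable_S {k : BondConfig (Site 3) → ℝ} (hk : Measurable k) : Measurable (S k) := by
  have h : S k = fun ω =>
      Pop ω (fun x => k (BondConfig.relabel (sym2Equiv (Site.shift (-x))) ω)) 0 :=
    funext fun ω => hS k ω
  rw [h]
  exact StubStationarity.measurable_pop_zero hPop hk

/-- `|S k| ≤ M` if `|k| ≤ M` (an average of numbers of modulus `≤ M`; `0` if `deg_ω(0) = 0`). -/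
theorem abs_S_le {k : BondConfig (Site 3) → ℝ} {M : ℝ} (hk : ∀ ω, |k ω| ≤ M)
    (ω : BondConfig (Site 3)) : |S k ω| ≤ M := by
  rw [hS, hPop]
  rcases (((zdGraph 3).neighborFinset (0 : Site 3)).filter
      (fun y => s((0 : Site 3), y) ∈ ω)).eq_empty_or_nonempty with h0 | hne
  · rw [h0, Finset.card_empty, Nat.cast_zero, div_zero, abs_zero]
    exact (abs_nonneg _).trans (hk ω)
  · rw [abs_div, Nat.abs_cast, div_le_iff₀ (Nat.cast_pos.2 hne.card_pos)]
    refine (Finset.abs_sum_le_sum_abs _ _).trans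
      ((Finset.sum_le_sum fun y _ => hk _).trans_eq ?_)
    rw [Finset.sum_const, nsmul_eq_mul, mul_comm]

/-- The iterates `S^[r] k` of a measurable `k` are measurable. -/
theorem measurable_S_iterate {k : BondConfig (Site 3) → ℝ} (hk : Measurable k) (r : ℕ) :
    Measurable (S^[r] k) := by
  induction r with
  | zero => exact hk
  | succ r ih =>
    rw [Function.iterate_succ_apply']
    exact measurable_S hPop hS ih

/-- The iterates `S^[r] k` of a function bounded by `M` are bounded by `M`. -/
theorem abs_S_iterate_le {k : BondConfig (Site 3) → ℝ} {M : ℝ} (hk : ∀ ω, |k ω| ≤ M) (r : ℕ) :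
    ∀ ω, |(S^[r] k) ω| ≤ M := by
  induction r with
  | zero => exact hk
  | succ r ih =>
    rw [Function.iterate_succ_apply']
    exact abs_S_le hPop hS ih

/-- **Iterate covariance** (the semigroup law): `(𝒫_ω^[r] (x ↦ k(ω - x)))(0) = (S^r k)(ω)`.
Induction on `r` generalizing `k`: `𝒫_ω (x ↦ k(ω - x)) = x ↦ (S k)(ω - x)` by the shift
covariance of the averaging operator (`StubStationarity.pop_seen_from`). -/
theorem iterate_apply_zero (r : ℕ) :
    ∀ (k : BondConfig (Site 3) → ℝ) (ω : BondConfig (Site 3)),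
      ((Pop ω)^[r] (fun x => k (BondConfig.relabel (sym2Equiv (Site.shift (-x))) ω))) 0 =
        (S^[r] k) ω := by
  induction r with
  | zero =>
    intro k ω
    simp only [Function.iterate_zero, id_eq, StubStationarity.relabel_shift_neg_zero]
  | succ r ih =>
    intro k ω
    have hstep : Pop ω (fun x => k (BondConfig.relabel (sym2Equiv (Site.shift (-x))) ω)) =
        fun x => S k (BondConfig.relabel (sym2Equiv (Site.shift (-x))) ω) :=
      funext fun x => by rw [hS]; exact StubStationarity.pop_seen_from hPop k ω x
    rw [Function.iterate_succ_apply, hstep, ih (S k) ω, ← Function.iterate_succ_apply]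

/-- `S` commutes with finite sums (the average is linear). -/
theorem S_sum {ι : Type*} (t : Finset ι) (f : ι → BondConfig (Site 3) → ℝ)
    (ω : BondConfig (Site 3)) : S (fun ω' => ∑ i ∈ t, f i ω') ω = ∑ i ∈ t, S (f i) ω := by
  simp only [hS, hPop]
  rw [Finset.sum_comm, Finset.sum_div]

/-- **One step, pointwise**: `deg_ω(0) · (S k)(ω) = ∑_{y ∈ N_ω(0)} k(ω - y)`. -/
theorem card_mul_S (k : BondConfig (Site 3) → ℝ) (ω : BondConfig (Site 3)) :
    ((((zdGraph 3).neighborFinset (0 : Site 3)).filter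
        (fun y => s((0 : Site 3), y) ∈ ω)).card : ℝ) * S k ω =
      ∑ y ∈ ((zdGraph 3).neighborFinset (0 : Site 3)).filter (fun y => s((0 : Site 3), y) ∈ ω),
        k (BondConfig.relabel (sym2Equiv (Site.shift (-y))) ω) := by
  rw [hS, StubStationarity.card_mul_pop_zero hPop, Finset.sum_filter]

/-- **Jensen / Cauchy–Schwarz for one step**: `deg_ω(0)·(S u)(ω)² ≤ deg_ω(0)·(S(u²))(ω)`
(`(∑_{y ∈ N} u_y)² ≤ #N · ∑_{y ∈ N} u_y²`, `sq_sum_le_card_mul_sum_sq`). -/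
theorem card_mul_S_mul_S_le (u : BondConfig (Site 3) → ℝ) (ω : BondConfig (Site 3)) :
    ((((zdGraph 3).neighborFinset (0 : Site 3)).filter
        (fun y => s((0 : Site 3), y) ∈ ω)).card : ℝ) * (S u ω * S u ω) ≤
      ((((zdGraph 3).neighborFinset (0 : Site 3)).filter
        (fun y => s((0 : Site 3), y) ∈ ω)).card : ℝ) * S (fun ω' => u ω' * u ω') ω := by
  rw [hS, hS, hPop, hPop]
  set N := ((zdGraph 3).neighborFinset (0 : Site 3)).filter (fun y => s((0 : Site 3), y) ∈ ω)
  rcases eq_or_ne (N.card : ℝ) 0 with h0 | hc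
  · rw [h0, zero_mul, zero_mul]
  · have hpos : (0 : ℝ) < N.card := lt_of_le_of_ne (Nat.cast_nonneg _) hc.symm
    rw [mul_div_cancel₀ _ hc, div_mul_div_comm, ← mul_div_assoc, mul_div_mul_left _ _ hc,
      div_le_iff₀ hpos, ← sq]
    calc (∑ y ∈ N, u (BondConfig.relabel (sym2Equiv (Site.shift (-y))) ω)) ^ 2
        ≤ N.card * ∑ y ∈ N, u (BondConfig.relabel (sym2Equiv (Site.shift (-y))) ω) ^ 2 :=
          sq_sum_le_card_mul_sum_sq
      _ = (∑ y ∈ N, u (BondConfig.relabel (sym2Equiv (Site.shift (-y))) ω) *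
            u (BondConfig.relabel (sym2Equiv (Site.shift (-y))) ω)) * N.card := by
          rw [mul_comm]
          exact congrArg (· * _) (Finset.sum_congr rfl fun y _ => sq _)

end Operator

end StubToeplitzPositivity

end Summit.CriticalPhenomena.PercolationContinuityZ3.Theorems.VerticalGamblersRuin
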